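/-
Copyright: cell pub-balaban-gaps (YM BLITZ Y1, track G1), seat g1-p2 GEN 11 (unit `pub-balaban-gaps-g1-p2`).  Row (D4) NODE O, MODEL level:
the AVERAGING BUDGET of `D4WalkBlockFormCovOpTorus.conjCoercive_compress_covOp` (its hypotheses `hAr ∕ hAc`: conjugated Schur sums of
`compress (P_K(U)(u) − P_K ⊗ 1) □̃`) SUPPLIED from the fibre letters of the block-contour transporters (64's `PU`: rows AND columns of
`U(Γ_{y,x}) − 1`, `U(Γ_{y,x})⁻¹ − 1` at most `α_g`) and the weight's oscillation `ℓ_B` on a K-block: `≤ e^{|κ|ℓ_B}(2α_g + α_g²)` — the block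
weights sum to one, so NO constant depends on the scale.  HONEST FRAMING: model-level bookkeeping ([folklore]); the transporter letters are
hypothesis data (66's `fibre_contour_letters`); Bałaban's `Δ^{(k)}(𝐔)` NOT constructed; (D4) instance 0∕1; NOT BetaPertH, NOT continuum, NOT Clay.
-/
import Summits.QuantumFields.BalabanUV.Gaps.D4WalkBlockCovariantBlockAveraging
import Summits.QuantumFields.BalabanUV.Gaps.D4WalkBlockLocalInverse

/-!
# `Gaps.D4WalkBlockFormAveragingTorus` — conjugated Schur sums of `compress (P_K(U) − P_K ⊗ 1) □̃` from the transporter letters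
# (cell pub-balaban-gaps, seat g1-p2 gen 11)

HONEST DEPENDENCY (cell pub-balaban, verbatim): continuum YM on T⁴ ⇐ BetaPertH ∧ nine spine estimates (0/9 proved); BetaPertH ⇐ (D1) ∧ (D4) ∧ CAP+tail.

[B9] (3.8) p. 392 ∕ (3.57)–(3.60) pp. 401–402: `P_k(U) − P_k(1)` is block-local with entries `L^{−kd}(U(Γ)⁻¹U(Γ′) − 1)`, small in the (3.37) window.
ON 64's OBJECTS ([folklore] throughout):
* §1 `PU_sub_Pf_apply` (the kernel `[B(x) = B(x′)]·L^{−Kd}·(U(Γ_{y,x})⁻¹U(Γ_{y,x′}) − 1)_{ab}`), `colSum_one_sub_mul_le` (the column twin of 64's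
  `rowSum_one_sub_mul_le`), **`rowSum_PU_sub_Pf_le`** ∕ **`colSum_PU_sub_Pf_le`** (plain row ∕ column sums `≤ 2α_g + α_g²`: 64's `sum_blockWeight`);
* §2 **`schur_PU_sub_Pf`**: for a weight oscillating by at most `ℓ_B` on a K-block, the conjugated row and column sums of `compress (PU u − Pf) S` are
  `≤ e^{|κ|ℓ_B}(2α_g + α_g²)` on the ball — the `γ_r = γ_c` of 114.
WHAT IT IS NOT.  The transporter letters from (3.37) (66), the assembly (114); (D4) instance 0∕1; words of row (D4) UNCHANGED
(`ExistsUniformAcrossSmall 𝓣_Bałaban α Rσ₀ θ₀` + `TermDomination`, OBJECT level).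

References (method only): T. Bałaban, Comm. Math. Phys. **99** (1985) 389–434 [B9], (3.8) p. 392, (3.37) p. 396, (3.57)–(3.60) pp. 401–402.
-/

noncomputable section

namespace Summit.QuantumFields.BalabanUV.Gaps.D4WalkBlockFormAveragingTorus

open Metric Set Finset Complex Matrix
open scoped BigOperators Matrix ComplexConjugate
open Literature.MathematicalPhysics.QuantumFieldTheory.Balaban1983to89
open Literature.MathematicalPhysics.QuantumFieldTheory.Balaban1983to89.B5Ineq137Torus (blk)
open Summit.QuantumFields.BalabanUV.Beta.UnitLatticeLocalInverse (compress)
open Summit.QuantumFields.BalabanUV.Gaps.D4WalkBlockCovariantPropagator (Pf)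
open Summit.QuantumFields.BalabanUV.Gaps.D4WalkBlockCovariantBlockAveraging (PU wK wK_nonneg Pf_apply sum_blockWeight rowSum_one_sub_mul_le)
open Summit.QuantumFields.BalabanUV.Gaps.D4WalkBlockLocalInverse (cRow cCol)

variable {P : Params} {F : Type} [Fintype F] [DecidableEq F]
variable {E : Type*} [NormedAddCommGroup E] [NormedSpace ℂ E]
variable {Ug Ugi : E → Site P 0 → Matrix F F ℂ}

/-! ## §1. The kernel of `P_K(U) − P_K ⊗ 1` and its plain row ∕ column sums -/

omit [NormedAddCommGroup E] [NormedSpace ℂ E] in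
/-- the kernel: `(P_K(U)(u) − P_K ⊗ 1)_{(x,a),(x′,b)} = [B(x) = B(x′)]·L^{−Kd}·(U(Γ_{y,x})⁻¹U(Γ_{y,x′}) − 1)_{ab}`. -/
theorem PU_sub_Pf_apply (u : E) (p q : Site P 0 × F) :
    (PU P F Ug Ugi u - Pf P F) p q = if blk P P.K p.1 = blk P P.K q.1 then (wK P : ℂ) * (Ugi u p.1 * Ug u q.1 - 1) p.2 q.2 else 0 := by
  rw [Matrix.sub_apply, Pf_apply, PU, Matrix.of_apply]
  by_cases h : blk P P.K p.1 = blk P P.K q.1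
  · simp only [h, if_true, Matrix.sub_apply, Matrix.one_apply]
    split_ifs <;> ring
  · simp [h]

/-- column sums of `AB − 1` from the COLUMN letters of `A − 1` and `B − 1`: at most `α + α′ + αα′`. -/
theorem colSum_mul_sub_one_le (A B : Matrix F F ℂ) {α α' : ℝ} (hα : 0 ≤ α)
    (hA : ∀ b, ∑ c, ‖(A - 1) c b‖ ≤ α) (hB : ∀ b, ∑ c, ‖(B - 1) c b‖ ≤ α') (b : F) :
    ∑ c, ‖(A * B - 1) c b‖ ≤ α + α' + α * α' := by
  classical
  have e : A * B - (1 : Matrix F F ℂ) = (A - 1) + (B - 1) + (A - 1) * (B - 1) := by noncomm_ring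
  rw [e]
  calc ∑ c, ‖((A - 1) + (B - 1) + (A - 1) * (B - 1)) c b‖
      ≤ ∑ c, (‖(A - 1) c b‖ + ‖(B - 1) c b‖ + ∑ e, ‖(A - 1) c e‖ * ‖(B - 1) e b‖) := Finset.sum_le_sum fun c _ => by
          rw [Matrix.add_apply, Matrix.add_apply, Matrix.mul_apply]
          refine (norm_add_le _ _).trans (add_le_add (norm_add_le _ _) ((norm_sum_le _ _).trans ?_))
          exact Finset.sum_le_sum fun e _ => (norm_mul_le _ _)
    _ = ∑ c, ‖(A - 1) c b‖ + ∑ c, ‖(B - 1) c b‖ + ∑ e, (∑ c, ‖(A - 1) c e‖) * ‖(B - 1) e b‖ := by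
          rw [Finset.sum_add_distrib, Finset.sum_add_distrib, Finset.sum_comm]
          simp only [Finset.sum_mul]
    _ ≤ α + α' + α * α' := by
          refine add_le_add (add_le_add (hA b) (hB b)) ?_
          calc ∑ e, (∑ c, ‖(A - 1) c e‖) * ‖(B - 1) e b‖ ≤ ∑ e, α * ‖(B - 1) e b‖ :=
                Finset.sum_le_sum fun e _ => mul_le_mul_of_nonneg_right (hA e) (norm_nonneg _)
            _ = α * ∑ e, ‖(B - 1) e b‖ := by rw [Finset.mul_sum]
            _ ≤ α * α' := mul_le_mul_of_nonneg_left (hB b) hα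

/-- row sums of `AB − 1` (64's `rowSum_one_sub_mul_le` up to the sign inside the norm). -/
theorem rowSum_mul_sub_one_le (A B : Matrix F F ℂ) {α α' : ℝ} (hα' : 0 ≤ α')
    (hA : ∀ c, ∑ b, ‖(A - 1) c b‖ ≤ α) (hB : ∀ c, ∑ b, ‖(B - 1) c b‖ ≤ α') (c : F) :
    ∑ b, ‖(A * B - 1) c b‖ ≤ α + α' + α * α' := by
  have h := rowSum_one_sub_mul_le F A B hα' hA hB c
  refine le_trans (le_of_eq (Finset.sum_congr rfl fun b _ => ?_)) h
  rw [← norm_neg, ← Matrix.neg_apply, neg_sub]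

variable {R αg : ℝ}

omit [NormedSpace ℂ E] in
/-- **plain ROW sums** of `P_K(U)(u) − P_K ⊗ 1`: `≤ 2α_g + α_g²` (the block weights sum to one). [cite: Balaban1985BackgroundPropagators, (3.57)–(3.60) pp.401–402] -/
theorem rowSum_PU_sub_Pf_le (hαg : 0 ≤ αg)
    (hUg : ∀ u ∈ ball (0 : E) R, ∀ x c, ∑ b, ‖(Ug u x - 1) c b‖ ≤ αg) (hUgi : ∀ u ∈ ball (0 : E) R, ∀ x c, ∑ b, ‖(Ugi u x - 1) c b‖ ≤ αg) :
    ∀ u ∈ ball (0 : E) R, ∀ p, ∑ q, ‖(PU P F Ug Ugi u - Pf P F) p q‖ ≤ 2 * αg + αg ^ 2 := by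
  intro u hu p
  have hw := wK_nonneg P
  calc ∑ q, ‖(PU P F Ug Ugi u - Pf P F) p q‖ = ∑ x', ∑ b, ‖(PU P F Ug Ugi u - Pf P F) p (x', b)‖ := by
        rw [← Finset.univ_product_univ, Finset.sum_product]
    _ ≤ ∑ x', (if blk P P.K p.1 = blk P P.K x' then wK P else 0) * (2 * αg + αg ^ 2) := Finset.sum_le_sum fun x' _ => by
        by_cases hb : blk P P.K p.1 = blk P P.K x'
        · rw [if_pos hb]
          calc ∑ b, ‖(PU P F Ug Ugi u - Pf P F) p (x', b)‖ = ∑ b, wK P * ‖(Ugi u p.1 * Ug u x' - 1) p.2 b‖ :=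
                Finset.sum_congr rfl fun b _ => by
                  rw [PU_sub_Pf_apply, if_pos hb, norm_mul, Complex.norm_real, Real.norm_of_nonneg hw]
            _ = wK P * ∑ b, ‖(Ugi u p.1 * Ug u x' - 1) p.2 b‖ := by rw [Finset.mul_sum]
            _ ≤ wK P * (2 * αg + αg ^ 2) := mul_le_mul_of_nonneg_left (by
                have h := rowSum_mul_sub_one_le (Ugi u p.1) (Ug u x') hαg (hUgi u hu p.1) (hUg u hu x') p.2
                nlinarith) hw
        · rw [if_neg hb, zero_mul]
          exact (Finset.sum_eq_zero fun b _ => by rw [PU_sub_Pf_apply, if_neg hb, norm_zero]).le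
    _ = 2 * αg + αg ^ 2 := by rw [← Finset.sum_mul, sum_blockWeight, one_mul]

omit [NormedSpace ℂ E] in
/-- **plain COLUMN sums** of `P_K(U)(u) − P_K ⊗ 1`: `≤ 2α_g + α_g²` from the COLUMN letters of the transporters. -/
theorem colSum_PU_sub_Pf_le (hαg : 0 ≤ αg)
    (hUg : ∀ u ∈ ball (0 : E) R, ∀ x b, ∑ c, ‖(Ug u x - 1) c b‖ ≤ αg) (hUgi : ∀ u ∈ ball (0 : E) R, ∀ x b, ∑ c, ‖(Ugi u x - 1) c b‖ ≤ αg) :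
    ∀ u ∈ ball (0 : E) R, ∀ q, ∑ p, ‖(PU P F Ug Ugi u - Pf P F) p q‖ ≤ 2 * αg + αg ^ 2 := by
  intro u hu q
  have hw := wK_nonneg P
  calc ∑ p, ‖(PU P F Ug Ugi u - Pf P F) p q‖ = ∑ x, ∑ c, ‖(PU P F Ug Ugi u - Pf P F) (x, c) q‖ := by
        rw [← Finset.univ_product_univ, Finset.sum_product]
    _ ≤ ∑ x, (if blk P P.K q.1 = blk P P.K x then wK P else 0) * (2 * αg + αg ^ 2) := Finset.sum_le_sum fun x _ => by
        by_cases hb : blk P P.K q.1 = blk P P.K x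
        · rw [if_pos hb]
          calc ∑ c, ‖(PU P F Ug Ugi u - Pf P F) (x, c) q‖ = ∑ c, wK P * ‖(Ugi u x * Ug u q.1 - 1) c q.2‖ :=
                Finset.sum_congr rfl fun c _ => by
                  rw [PU_sub_Pf_apply, if_pos hb.symm, norm_mul, Complex.norm_real, Real.norm_of_nonneg hw]
            _ = wK P * ∑ c, ‖(Ugi u x * Ug u q.1 - 1) c q.2‖ := by rw [Finset.mul_sum]
            _ ≤ wK P * (2 * αg + αg ^ 2) := mul_le_mul_of_nonneg_left (by
                have h := colSum_mul_sub_one_le (Ugi u x) (Ug u q.1) hαg (hUgi u hu x) (hUg u hu q.1) q.2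
                nlinarith) hw
        · rw [if_neg hb, zero_mul]
          exact (Finset.sum_eq_zero fun c _ => by rw [PU_sub_Pf_apply]; simp [Ne.symm hb]).le
    _ = 2 * αg + αg ^ 2 := by rw [← Finset.sum_mul, sum_blockWeight, one_mul]

/-! ## §2. The conjugated Schur sums on a cube -/

omit [NormedSpace ℂ E] in
/-- **THE AVERAGING BUDGET OF 114**: for a weight oscillating by at most `ℓ_B` on every K-block and transporters with row AND column letters
`α_g ≥ 0` on the ball, the conjugated row and column sums of `compress (P_K(U)(u) − P_K ⊗ 1) S` are `≤ e^{|κ|ℓ_B}(2α_g + α_g²)` — the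
`γ_r = γ_c` of `D4WalkBlockFormCovOpTorus.conjCoercive_compress_covOp`, free of the scale. [cite: Balaban1985BackgroundPropagators, (3.8) p.392, (3.57)–(3.60) pp.401–402] -/
theorem schur_PU_sub_Pf (hαg : 0 ≤ αg)
    (hUg : ∀ u ∈ ball (0 : E) R, ∀ x c, ∑ b, ‖(Ug u x - 1) c b‖ ≤ αg ∧ ∑ b, ‖(Ug u x - 1) b c‖ ≤ αg)
    (hUgi : ∀ u ∈ ball (0 : E) R, ∀ x c, ∑ b, ‖(Ugi u x - 1) c b‖ ≤ αg ∧ ∑ b, ‖(Ugi u x - 1) b c‖ ≤ αg)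
    (ρ : Site P 0 × F → ℝ) {ℓB : ℝ} (hρB : ∀ p q : Site P 0 × F, blk P P.K p.1 = blk P P.K q.1 → |ρ p - ρ q| ≤ ℓB)
    (S : Finset (Site P 0 × F)) (κ : ℝ) :
    ∀ u ∈ ball (0 : E) R, ∀ e : S,
      cRow (compress (PU P F Ug Ugi u - Pf P F) S) κ (fun e : S => ρ e) e ≤ Real.exp (|κ| * ℓB) * (2 * αg + αg ^ 2) ∧
      cCol (compress (PU P F Ug Ugi u - Pf P F) S) κ (fun e : S => ρ e) e ≤ Real.exp (|κ| * ℓB) * (2 * αg + αg ^ 2) := by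
  intro u hu e
  -- on the support of the kernel the weight factor is at most `e^{|κ|ℓ_B}`
  have hwt : ∀ p q : Site P 0 × F, ‖(PU P F Ug Ugi u - Pf P F) p q‖ * Real.exp (κ * (ρ p - ρ q))
      ≤ ‖(PU P F Ug Ugi u - Pf P F) p q‖ * Real.exp (|κ| * ℓB) := by
    intro p q
    by_cases hb : blk P P.K p.1 = blk P P.K q.1
    · refine mul_le_mul_of_nonneg_left (Real.exp_le_exp.mpr ?_) (norm_nonneg _)
      calc κ * (ρ p - ρ q) ≤ |κ * (ρ p - ρ q)| := le_abs_self _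
        _ = |κ| * |ρ p - ρ q| := abs_mul _ _
        _ ≤ |κ| * ℓB := mul_le_mul_of_nonneg_left (hρB p q hb) (abs_nonneg _)
    · rw [PU_sub_Pf_apply, if_neg hb, norm_zero, zero_mul, zero_mul]
  constructor
  · calc cRow (compress (PU P F Ug Ugi u - Pf P F) S) κ (fun e : S => ρ e) e
        ≤ ∑ e' : S, ‖(PU P F Ug Ugi u - Pf P F) e e'‖ * Real.exp (|κ| * ℓB) := Finset.sum_le_sum fun e' _ => hwt e e'
      _ = (∑ e' : S, ‖(PU P F Ug Ugi u - Pf P F) e e'‖) * Real.exp (|κ| * ℓB) := by rw [Finset.sum_mul]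
      _ ≤ (∑ q, ‖(PU P F Ug Ugi u - Pf P F) e q‖) * Real.exp (|κ| * ℓB) := by
          refine mul_le_mul_of_nonneg_right ?_ (Real.exp_nonneg _)
          rw [Finset.sum_coe_sort S (fun q => ‖(PU P F Ug Ugi u - Pf P F) e q‖)]
          exact Finset.sum_le_sum_of_subset_of_nonneg (Finset.subset_univ S) fun q _ _ => norm_nonneg _
      _ ≤ (2 * αg + αg ^ 2) * Real.exp (|κ| * ℓB) :=
          mul_le_mul_of_nonneg_right (rowSum_PU_sub_Pf_le hαg (fun u hu x c => (hUg u hu x c).1) (fun u hu x c => (hUgi u hu x c).1) u hu e)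
            (Real.exp_nonneg _)
      _ = Real.exp (|κ| * ℓB) * (2 * αg + αg ^ 2) := mul_comm _ _
  · calc cCol (compress (PU P F Ug Ugi u - Pf P F) S) κ (fun e : S => ρ e) e
        ≤ ∑ e' : S, ‖(PU P F Ug Ugi u - Pf P F) e' e‖ * Real.exp (|κ| * ℓB) := Finset.sum_le_sum fun e' _ => hwt e' e
      _ = (∑ e' : S, ‖(PU P F Ug Ugi u - Pf P F) e' e‖) * Real.exp (|κ| * ℓB) := by rw [Finset.sum_mul]
      _ ≤ (∑ p, ‖(PU P F Ug Ugi u - Pf P F) p e‖) * Real.exp (|κ| * ℓB) := by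
          refine mul_le_mul_of_nonneg_right ?_ (Real.exp_nonneg _)
          rw [Finset.sum_coe_sort S (fun p => ‖(PU P F Ug Ugi u - Pf P F) p e‖)]
          exact Finset.sum_le_sum_of_subset_of_nonneg (Finset.subset_univ S) fun p _ _ => norm_nonneg _
      _ ≤ (2 * αg + αg ^ 2) * Real.exp (|κ| * ℓB) :=
          mul_le_mul_of_nonneg_right (colSum_PU_sub_Pf_le hαg (fun u hu x c => (hUg u hu x c).2) (fun u hu x c => (hUgi u hu x c).2) u hu e)
            (Real.exp_nonneg _)
      _ = Real.exp (|κ| * ℓB) * (2 * αg + αg ^ 2) := mul_comm _ _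

end Summit.QuantumFields.BalabanUV.Gaps.D4WalkBlockFormAveragingTorus

end
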